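import Mathlib
import Literature.NumberTheory.Sieve.Maynard2016L1DensitySections
import HarnessLib

/-!
# Maynard 2016, Lemma 8: smoothing grid histograms into bump data (proved reduction)

Topic `Literature/NumberTheory/Sieve`. J. Maynard, *Large gaps between primes*, Ann. of Math. (2)
183 (2016), 915–933 = arXiv:1408.5110, §8, proof of Lemma 8 (approximation step "such functions
are dense").

After `Maynard2016L1DensitySections` the only analytic input left in the proof of Lemma 8 is
`L1DensityOrth`: `[0,1]`-valued measurable `G(t) = F(10t)` supported in `{t ≥ 0, Σ t_ℓ ≤ 1/10}` is
`L¹`-approximated on the orthant by sums `P = Σ_j c_j ∏_ℓ φ_{ℓ,j}(t_ℓ) ≤ 1` of smooth product bumps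
with the box condition `Σ_ℓ w_{ℓ,j} ≤ 1/10` (`IsBumpData`). This file performs the SMOOTHING half
of that approximation and leaves a statement about plain HISTOGRAMS:

* grid of mesh `h = 1/(10m)` (`gridH`), open cells `Q_a = ∏_ℓ (a_ℓ h, (a_ℓ+1)h)` (`cell`), good
  cells `Σ_ℓ (a_ℓ + 1) ≤ m` (`goodCells`; exactly the cells whose closure lies in `{Σ t ≤ 1/10}`),
  histograms `S = Σ_{a good} c_a 1_{Q_a}` (`histFun`);
* `HistDensity` — for `k ≥ 1`, measurable `F : ℝ^k → [0,1]` supported in `R_k` and `δ > 0` there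
  are `m ≥ 1` and coefficients `c_a ∈ [0,1]` with `∫_{t ≥ 0} |S(t) − F(10t)| dt ≤ δ`. Named fact,
  not proved here (Lebesgue differentiation / density of continuous functions + the face layer
  `{1/10 − kh ≤ Σ t ≤ 1/10}` has volume `→ 0`);
* `l1DensityOrth_of_histDensity : HistDensity → L1DensityOrth` — PROVED: each indicator `1_{Q_a}`
  is replaced by the smooth product `ψ_a = ∏_ℓ β_{a_ℓ h,(a_ℓ+1)h,ρ}(t_ℓ)` (`cellPsi`, `cellBump`), with
  `|ψ_a − 1_{Q_a}| ≤ 1_{ramp}` (`abs_cellPsi_sub_indicator_le`), `vol(ramp) = h^k − (h − 2ρ)^k`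
  (`volume_real_ramp`) and `ρ → 0` (`exists_ramp_small`); the cells with `c_a > 0` are enumerated
  by `Fin J`, `w_{ℓ,j} = (a_ℓ+1)h` so `Σ_ℓ w_{ℓ,j} ≤ mh = 1/10`, and `P ≤ 1` because distinct open
  cells are disjoint (`eq_of_mem_cell`).

Hence `theorem1_of_lemma7_histDensity : Lemma7 → HistDensity → Maynard2016_theorem1`.

## References

* J. Maynard, *Large gaps between primes*, Ann. of Math. (2) 183 (2016), 915–933; arXiv:1408.5110,
  Lemma 8 (proof, approximation step). [Maynard2016LargeGaps]
-/

open Filter Finset MeasureTheory Set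
open scoped Topology ContDiff

namespace Literature.NumberTheory.Sieve

namespace Maynard2016

/-! ### The grid -/

/-- The mesh `h = 1/(10m)`. [cite: Maynard2016LargeGaps, Lemma 8 (proof)] -/
noncomputable def gridH (m : ℕ) : ℝ := 1 / (10 * (m : ℝ))

/-- `h > 0` for `m ≥ 1`. [cite: Maynard2016LargeGaps, Lemma 8 (proof)] -/
theorem gridH_pos {m : ℕ} (hm : 1 ≤ m) : 0 < gridH m := by
  unfold gridH
  have : (1 : ℝ) ≤ m := by exact_mod_cast hm
  positivity

/-- `m h = 1/10`. [cite: Maynard2016LargeGaps, Lemma 8 (proof)] -/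
theorem natCast_mul_gridH {m : ℕ} (hm : 1 ≤ m) : (m : ℝ) * gridH m = 1 / 10 := by
  unfold gridH
  have : (m : ℝ) ≠ 0 := by
    have : (1 : ℝ) ≤ m := by exact_mod_cast hm
    exact ne_of_gt (by linarith)
  field_simp

/-- Lower corner `(a_ℓ h)_ℓ` of the cell `a`. [cite: Maynard2016LargeGaps, Lemma 8 (proof)] -/
noncomputable def cellLo (k m : ℕ) (a : Fin k → ℕ) : Fin k → ℝ := fun ℓ => (a ℓ : ℝ) * gridH m

/-- Upper corner `((a_ℓ + 1) h)_ℓ` of the cell `a`. [cite: Maynard2016LargeGaps, Lemma 8 (proof)] -/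
noncomputable def cellHi (k m : ℕ) (a : Fin k → ℕ) : Fin k → ℝ :=
  fun ℓ => ((a ℓ : ℝ) + 1) * gridH m

/-- The open grid cell `Q_a = ∏_ℓ (a_ℓ h, (a_ℓ+1) h)`. [cite: Maynard2016LargeGaps, Lemma 8 (proof)] -/
def cell (k m : ℕ) (a : Fin k → ℕ) : Set (Fin k → ℝ) :=
  Set.univ.pi fun ℓ => Set.Ioo (cellLo k m a ℓ) (cellHi k m a ℓ)

/-- The good cells: `a_ℓ < m` and `Σ_ℓ (a_ℓ + 1) ≤ m`, i.e. the closed cell lies in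
`{t ≥ 0, Σ t_ℓ ≤ 1/10}`. [cite: Maynard2016LargeGaps, Lemma 8 (proof)] -/
def goodCells (k m : ℕ) : Finset (Fin k → ℕ) :=
  (Fintype.piFinset fun _ : Fin k => Finset.range m).filter fun a => ∑ ℓ, (a ℓ + 1) ≤ m

/-- The histogram `S(t) = Σ_{a good} c_a 1_{Q_a}(t)`. [cite: Maynard2016LargeGaps, Lemma 8 (proof)] -/
noncomputable def histFun (k m : ℕ) (c : (Fin k → ℕ) → ℝ) (t : Fin k → ℝ) : ℝ :=
  ∑ a ∈ goodCells k m, c a * (cell k m a).indicator (fun _ => (1 : ℝ)) t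

/-- **Histogram density (named fact, not proved here).** For `k ≥ 1`, a measurable
`F : ℝ^k → [0,1]` supported in `R_k` and `δ > 0`, there are `m ≥ 1` and coefficients `c_a ∈ [0,1]`
on the good cells of mesh `1/(10m)` with `∫_{t ≥ 0} |Σ_a c_a 1_{Q_a}(t) − F(10t)| dt ≤ δ`
(take `c_a` = the average of `F(10·)` over `Q_a` and `m` large: Lebesgue differentiation, plus the
vanishing volume of the face layer). [cite: Maynard2016LargeGaps, Lemma 8 (proof, "such functions are dense")] -/
def HistDensity : Prop :=
  ∀ k : ℕ, 1 ≤ k → ∀ F : (Fin k → ℝ) → ℝ, Measurable F → Function.support F ⊆ maynardSimplex k →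
    (∀ t, 0 ≤ F t ∧ F t ≤ 1) → ∀ δ : ℝ, 0 < δ →
      ∃ m : ℕ, 1 ≤ m ∧ ∃ c : (Fin k → ℕ) → ℝ, (∀ a, 0 ≤ c a ∧ c a ≤ 1) ∧
        ∫ t in Set.univ.pi (fun _ : Fin k => Set.Ici (0 : ℝ)),
            |histFun k m c t - F ((10 : ℝ) • t)| ≤ δ

/-! ### Cells: membership, disjointness, measure -/

/-- Membership in an open cell, coordinatewise. [cite: Maynard2016LargeGaps, Lemma 8 (proof)] -/
theorem mem_cell_iff {k m : ℕ} {a : Fin k → ℕ} {t : Fin k → ℝ} :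
    t ∈ cell k m a ↔ ∀ ℓ, cellLo k m a ℓ < t ℓ ∧ t ℓ < cellHi k m a ℓ := by
  simp only [cell, Set.mem_univ_pi, Set.mem_Ioo]

/-- Distinct open cells are disjoint. [cite: Maynard2016LargeGaps, Lemma 8 (proof)] -/
theorem eq_of_mem_cell {k m : ℕ} (hm : 1 ≤ m) {a b : Fin k → ℕ} {t : Fin k → ℝ}
    (ha : t ∈ cell k m a) (hb : t ∈ cell k m b) : a = b := by
  have hh := gridH_pos hm
  funext ℓ
  obtain ⟨ha1, ha2⟩ := mem_cell_iff.1 ha ℓ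
  obtain ⟨hb1, hb2⟩ := mem_cell_iff.1 hb ℓ
  simp only [cellLo, cellHi] at ha1 ha2 hb1 hb2
  have h1 : (a ℓ : ℝ) < (b ℓ : ℝ) + 1 := lt_of_mul_lt_mul_right (ha1.trans hb2) hh.le
  have h2 : (b ℓ : ℝ) < (a ℓ : ℝ) + 1 := lt_of_mul_lt_mul_right (hb1.trans ha2) hh.le
  have h1' : a ℓ < b ℓ + 1 := by exact_mod_cast h1
  have h2' : b ℓ < a ℓ + 1 := by exact_mod_cast h2
  omega

/-- Open cells are measurable. [cite: Maynard2016LargeGaps, Lemma 8 (proof)] -/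
theorem measurableSet_cell {k m : ℕ} (a : Fin k → ℕ) : MeasurableSet (cell k m a) :=
  MeasurableSet.univ_pi fun _ => measurableSet_Ioo

/-- The open cell lies in the closed cell. [cite: Maynard2016LargeGaps, Lemma 8 (proof)] -/
theorem cell_subset_Icc {k m : ℕ} (a : Fin k → ℕ) :
    cell k m a ⊆ Set.Icc (cellLo k m a) (cellHi k m a) := by
  intro t ht
  rw [mem_cell_iff] at ht
  exact ⟨fun ℓ => (ht ℓ).1.le, fun ℓ => (ht ℓ).2.le⟩

/-- Each side of a cell has length `h`. [cite: Maynard2016LargeGaps, Lemma 8 (proof)] -/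
theorem cellHi_sub_cellLo {k m : ℕ} (a : Fin k → ℕ) (ℓ : Fin k) :
    cellHi k m a ℓ - cellLo k m a ℓ = gridH m := by
  simp only [cellHi, cellLo]; ring

/-- Closed cells have finite volume. [cite: Maynard2016LargeGaps, Lemma 8 (proof)] -/
theorem volume_Icc_cell_ne_top {k m : ℕ} (a : Fin k → ℕ) :
    volume (Set.Icc (cellLo k m a) (cellHi k m a)) ≠ ⊤ := by
  rw [Real.volume_Icc_pi]
  exact ENNReal.prod_ne_top fun _ _ => ENNReal.ofReal_ne_top

/-- Open cells have finite volume. [cite: Maynard2016LargeGaps, Lemma 8 (proof)] -/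
theorem volume_cell_ne_top {k m : ℕ} (a : Fin k → ℕ) : volume (cell k m a) ≠ ⊤ :=
  measure_ne_top_of_subset (cell_subset_Icc a) (volume_Icc_cell_ne_top a)

/-! ### The smoothed cell indicator -/

/-- `ψ_a(t) = ∏_ℓ β_{a_ℓ h, (a_ℓ+1) h, ρ}(t_ℓ)`. [cite: Maynard2016LargeGaps, Lemma 8 (proof)] -/
noncomputable def cellPsi (k m : ℕ) (ρ : ℝ) (a : Fin k → ℕ) (t : Fin k → ℝ) : ℝ :=
  ∏ ℓ, cellBump (cellLo k m a ℓ) (cellHi k m a ℓ) ρ (t ℓ)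

/-- `ψ_a ≥ 0`. [cite: Maynard2016LargeGaps, Lemma 8 (proof)] -/
theorem cellPsi_nonneg {k m : ℕ} (ρ : ℝ) (a : Fin k → ℕ) (t : Fin k → ℝ) :
    0 ≤ cellPsi k m ρ a t :=
  Finset.prod_nonneg fun _ _ => cellBump_nonneg _ _ _ _

/-- `ψ_a ≤ 1`. [cite: Maynard2016LargeGaps, Lemma 8 (proof)] -/
theorem cellPsi_le_one {k m : ℕ} (ρ : ℝ) (a : Fin k → ℕ) (t : Fin k → ℝ) :
    cellPsi k m ρ a t ≤ 1 :=
  Finset.prod_le_one (fun _ _ => cellBump_nonneg _ _ _ _) fun _ _ => cellBump_le_one _ _ _ _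

/-- `ψ_a(t) = 0` off the open cell. [cite: Maynard2016LargeGaps, Lemma 8 (proof)] -/
theorem cellPsi_eq_zero_of_not_mem {k m : ℕ} {ρ : ℝ} (hρ : 0 < ρ) {a : Fin k → ℕ}
    {t : Fin k → ℝ} (ht : t ∉ cell k m a) : cellPsi k m ρ a t = 0 := by
  rw [mem_cell_iff] at ht
  obtain ⟨ℓ, hℓ⟩ := not_forall.1 ht
  unfold cellPsi
  refine Finset.prod_eq_zero (Finset.mem_univ ℓ) ?_
  by_cases h1 : cellLo k m a ℓ < t ℓ
  · exact cellBump_of_ge_right hρ (not_lt.1 fun h2 => hℓ ⟨h1, h2⟩)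
  · exact cellBump_of_le_left hρ (not_lt.1 h1)

/-- `ψ_a(t) = 1` on the shrunk cell. [cite: Maynard2016LargeGaps, Lemma 8 (proof)] -/
theorem cellPsi_eq_one {k m : ℕ} {ρ : ℝ} (hρ : 0 < ρ) {a : Fin k → ℕ} {t : Fin k → ℝ}
    (ht : ∀ ℓ, cellLo k m a ℓ + ρ ≤ t ℓ ∧ t ℓ ≤ cellHi k m a ℓ - ρ) : cellPsi k m ρ a t = 1 := by
  unfold cellPsi
  exact Finset.prod_eq_one fun ℓ _ => cellBump_eq_one hρ (ht ℓ).1 (ht ℓ).2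

/-- The ramp region: closed cell minus shrunk cell. [cite: Maynard2016LargeGaps, Lemma 8 (proof)] -/
def ramp (k m : ℕ) (ρ : ℝ) (a : Fin k → ℕ) : Set (Fin k → ℝ) :=
  Set.Icc (cellLo k m a) (cellHi k m a) \
    Set.Icc (fun ℓ => cellLo k m a ℓ + ρ) (fun ℓ => cellHi k m a ℓ - ρ)

/-- Ramps are measurable. [cite: Maynard2016LargeGaps, Lemma 8 (proof)] -/
theorem measurableSet_ramp {k m : ℕ} (ρ : ℝ) (a : Fin k → ℕ) : MeasurableSet (ramp k m ρ a) :=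
  measurableSet_Icc.diff measurableSet_Icc

/-- Ramps have finite volume. [cite: Maynard2016LargeGaps, Lemma 8 (proof)] -/
theorem volume_ramp_ne_top {k m : ℕ} (ρ : ℝ) (a : Fin k → ℕ) : volume (ramp k m ρ a) ≠ ⊤ :=
  measure_ne_top_of_subset Set.sdiff_subset (volume_Icc_cell_ne_top a)

/-- **`|ψ_a − 1_{Q_a}| ≤ 1_{ramp}` pointwise.** [cite: Maynard2016LargeGaps, Lemma 8 (proof)] -/
theorem abs_cellPsi_sub_indicator_le {k m : ℕ} {ρ : ℝ} (hρ : 0 < ρ) (a : Fin k → ℕ)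
    (t : Fin k → ℝ) :
    |cellPsi k m ρ a t - (cell k m a).indicator (fun _ => (1 : ℝ)) t| ≤
      (ramp k m ρ a).indicator (fun _ => (1 : ℝ)) t := by
  by_cases hR : t ∈ ramp k m ρ a
  · rw [Set.indicator_of_mem hR]
    have h0 := cellPsi_nonneg (m := m) ρ a t
    have h1 := cellPsi_le_one (m := m) ρ a t
    by_cases hQ : t ∈ cell k m a
    · rw [Set.indicator_of_mem hQ, abs_le]
      constructor <;> linarith
    · rw [Set.indicator_of_notMem hQ, sub_zero, abs_of_nonneg h0]
      exact h1
  · rw [Set.indicator_of_notMem hR]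
    by_cases hC : t ∈ Set.Icc (cellLo k m a) (cellHi k m a)
    · -- `t` lies in the shrunk cell
      have hS : t ∈ Set.Icc (fun ℓ => cellLo k m a ℓ + ρ) (fun ℓ => cellHi k m a ℓ - ρ) := by
        by_contra hS
        exact hR ⟨hC, hS⟩
      have hS' : ∀ ℓ, cellLo k m a ℓ + ρ ≤ t ℓ ∧ t ℓ ≤ cellHi k m a ℓ - ρ :=
        fun ℓ => ⟨hS.1 ℓ, hS.2 ℓ⟩
      have hQ : t ∈ cell k m a :=
        mem_cell_iff.2 fun ℓ => ⟨by linarith [(hS' ℓ).1], by linarith [(hS' ℓ).2]⟩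
      rw [cellPsi_eq_one hρ hS', Set.indicator_of_mem hQ, sub_self, abs_zero]
    · have hQ : t ∉ cell k m a := fun h => hC (cell_subset_Icc a h)
      rw [cellPsi_eq_zero_of_not_mem hρ hQ, Set.indicator_of_notMem hQ, sub_zero, abs_zero]

/-- `vol(ramp) = h^k − (h − 2ρ)^k` for `0 ≤ 2ρ ≤ h`. [cite: Maynard2016LargeGaps, Lemma 8 (proof)] -/
theorem volume_real_ramp {k m : ℕ} (hm : 1 ≤ m) {ρ : ℝ} (hρ : 0 ≤ ρ) (h2 : 2 * ρ ≤ gridH m)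
    (a : Fin k → ℕ) :
    volume.real (ramp k m ρ a) = gridH m ^ k - (gridH m - 2 * ρ) ^ k := by
  have hh := gridH_pos hm
  have hsub : Set.Icc (fun ℓ => cellLo k m a ℓ + ρ) (fun ℓ => cellHi k m a ℓ - ρ) ⊆
      Set.Icc (cellLo k m a) (cellHi k m a) := by
    intro t ht
    exact ⟨fun ℓ => by linarith [ht.1 ℓ], fun ℓ => by
      have := ht.2 ℓ
      simp only at this
      linarith⟩
  unfold ramp
  rw [measureReal_sdiff hsub measurableSet_Icc (volume_Icc_cell_ne_top a), measureReal_def,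
    measureReal_def, Real.volume_Icc_pi_toReal, Real.volume_Icc_pi_toReal]
  · have e1 : ∀ ℓ : Fin k, cellHi k m a ℓ - cellLo k m a ℓ = gridH m := cellHi_sub_cellLo a
    have e2 : ∀ ℓ : Fin k, (cellHi k m a ℓ - ρ) - (cellLo k m a ℓ + ρ) = gridH m - 2 * ρ := by
      intro ℓ; rw [← e1 ℓ]; ring
    simp only [e1, e2, Finset.prod_const, Finset.card_univ, Fintype.card_fin]
  · intro ℓ
    show cellLo k m a ℓ + ρ ≤ cellHi k m a ℓ - ρ
    linarith [cellHi_sub_cellLo (m := m) a ℓ]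
  · intro ℓ
    linarith [cellHi_sub_cellLo (m := m) a ℓ]

/-- A ramp width `ρ` with `J (h^k − (h−2ρ)^k) ≤ ε`. [cite: Maynard2016LargeGaps, Lemma 8 (proof)] -/
theorem exists_ramp_small (k J : ℕ) {h : ℝ} (hh : 0 < h) {ε : ℝ} (hε : 0 < ε) :
    ∃ ρ : ℝ, 0 < ρ ∧ 2 * ρ ≤ h ∧ (J : ℝ) * (h ^ k - (h - 2 * ρ) ^ k) ≤ ε := by
  have hcont : Continuous fun ρ : ℝ => (J : ℝ) * (h ^ k - (h - 2 * ρ) ^ k) := by fun_prop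
  have hf0 : (fun ρ : ℝ => (J : ℝ) * (h ^ k - (h - 2 * ρ) ^ k)) 0 < ε := by
    simp only [mul_zero, sub_zero, sub_self]
    exact hε
  have hev := (tendsto_order.1 (hcont.tendsto 0)).2 ε hf0
  obtain ⟨η, hη, hball⟩ := Metric.eventually_nhds_iff.1 hev
  refine ⟨min (η / 2) (h / 2), lt_min (by linarith) (by linarith), ?_, ?_⟩
  · linarith [min_le_right (η / 2) (h / 2)]
  · refine le_of_lt (hball ?_)
    rw [Real.dist_eq, sub_zero, abs_of_pos (lt_min (by linarith) (by linarith))]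
    linarith [min_le_left (η / 2) (h / 2)]

/-! ### Integrability of histograms and of `F(10t)` on the orthant -/

/-- Histograms are integrable. [cite: Maynard2016LargeGaps, Lemma 8 (proof)] -/
theorem integrable_histFun {k m : ℕ} (c : (Fin k → ℕ) → ℝ) : Integrable (histFun k m c) := by
  unfold histFun
  refine integrable_finsetSum _ fun a _ => Integrable.const_mul ?_ (c a)
  rw [integrable_indicator_iff (measurableSet_cell a)]
  exact integrableOn_const (volume_cell_ne_top a)

/-- Histograms are measurable. [cite: Maynard2016LargeGaps, Lemma 8 (proof)] -/
theorem measurable_histFun {k m : ℕ} (c : (Fin k → ℕ) → ℝ) : Measurable (histFun k m c) := by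
  unfold histFun
  refine Finset.measurable_sum _ fun a _ => Measurable.const_mul ?_ (c a)
  exact measurable_const.indicator (measurableSet_cell a)

/-- `F(10t)` is integrable on the orthant (`F : ℝ^k → [0,1]` measurable, supported in `R_k`).
[cite: Maynard2016LargeGaps, Lemma 8 (proof)] -/
theorem integrableOn_scaled_orthant {k : ℕ} {F : (Fin k → ℝ) → ℝ} (hFm : Measurable F)
    (hFs : Function.support F ⊆ maynardSimplex k) (hF01 : ∀ t, 0 ≤ F t ∧ F t ≤ 1) :
    IntegrableOn (fun t : Fin k → ℝ => F ((10 : ℝ) • t))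
      (Set.univ.pi fun _ : Fin k => Set.Ici (0 : ℝ)) := by
  have hboxm : MeasurableSet (Set.univ.pi fun _ : Fin k => Set.Icc (0 : ℝ) (1 / 10)) :=
    MeasurableSet.univ_pi fun _ => measurableSet_Icc
  have horthm : MeasurableSet (Set.univ.pi fun _ : Fin k => Set.Ici (0 : ℝ)) :=
    MeasurableSet.univ_pi fun _ => measurableSet_Ici
  have hGm : Measurable fun t : Fin k → ℝ => F ((10 : ℝ) • t) :=
    hFm.comp (measurable_const_smul (10 : ℝ))
  refine IntegrableOn.of_forall_sdiff_eq_zero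
    (s := Set.univ.pi fun _ : Fin k => Set.Icc (0 : ℝ) (1 / 10)) ?_ horthm (fun t ht => ?_)
  · refine integrableOn_of_abs_le hboxm (volume_tenthBox_ne_top k) hGm (M := 1) fun t _ => ?_
    rw [abs_le]
    exact ⟨by linarith [(hF01 ((10 : ℝ) • t)).1], (hF01 ((10 : ℝ) • t)).2⟩
  · obtain ⟨hto, htb⟩ := ht
    have : ∃ ℓ, 1 / 10 < t ℓ := by
      by_contra hcon
      refine htb (Set.mem_univ_pi.2 fun ℓ => ⟨Set.mem_Ici.1 (Set.mem_univ_pi.1 hto ℓ), ?_⟩)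
      exact not_lt.1 fun hlt => hcon ⟨ℓ, hlt⟩
    obtain ⟨ℓ, hℓ⟩ := this
    exact scaled_eq_zero_of_lt hFs hℓ

/-! ### Smoothing: `HistDensity → L1DensityOrth` -/

/-- **Maynard 2016, Lemma 8, approximation step: histograms suffice (PROVED).** Smooth each
good-cell indicator into a product bump with a thin ramp, drop the cells with `c_a = 0`, and
enumerate the rest. [cite: Maynard2016LargeGaps, Lemma 8 (proof, approximation step)] -/
theorem l1DensityOrth_of_histDensity (hH : HistDensity) : L1DensityOrth := by
  intro k hk F hFm hFs hF01 δ hδ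
  obtain ⟨m, hm, c, hc01, hS⟩ := hH k hk F hFm hFs hF01 (δ / 2) (by linarith)
  have hh := gridH_pos hm
  set orth := Set.univ.pi fun _ : Fin k => Set.Ici (0 : ℝ) with horth
  have horthm : MeasurableSet orth := MeasurableSet.univ_pi fun _ => measurableSet_Ici
  set G : (Fin k → ℝ) → ℝ := fun t => F ((10 : ℝ) • t) with hG
  -- the cells that are actually used
  set A : Finset (Fin k → ℕ) := (goodCells k m).filter fun a => 0 < c a with hA
  set J : ℕ := A.card with hJ
  set σ : ↥A ≃ Fin J := A.equivFin with hσ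
  set aOf : Fin J → (Fin k → ℕ) := fun j => (σ.symm j).1 with haOf
  have haA : ∀ j, aOf j ∈ A := fun j => (σ.symm j).2
  have haGood : ∀ j, aOf j ∈ goodCells k m := fun j => (Finset.mem_filter.1 (haA j)).1
  have haPos : ∀ j, 0 < c (aOf j) := fun j => (Finset.mem_filter.1 (haA j)).2
  have haInj : Function.Injective aOf := by
    intro j j' hjj
    exact σ.symm.injective (Subtype.ext hjj)
  -- the ramp width
  obtain ⟨ρ, hρ, hρh, hρJ⟩ := exists_ramp_small k J hh (half_pos hδ)
  -- the data
  set c' : Fin J → ℝ := fun j => c (aOf j) with hc'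
  set w : Fin k → Fin J → ℝ := fun ℓ j => cellHi k m (aOf j) ℓ with hw
  set φ : Fin k → Fin J → ℝ → ℝ :=
    fun ℓ j => cellBump (cellLo k m (aOf j) ℓ) (cellHi k m (aOf j) ℓ) ρ with hφ
  have hdata : IsBumpData k J w φ := by
    refine ⟨fun ℓ j => cellBump_contDiff _ _ _, fun ℓ j v => cellBump_nonneg _ _ _ _,
      fun ℓ j v hv => cellBump_of_ge_right hρ hv, fun ℓ j => ?_, fun j => ?_⟩
    · refine ⟨((aOf j ℓ : ℝ) + 1 / 2) * gridH m, by positivity, cellBump_pos hρ ?_ ?_⟩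
      · show (aOf j ℓ : ℝ) * gridH m < ((aOf j ℓ : ℝ) + 1 / 2) * gridH m
        exact mul_lt_mul_of_pos_right (by linarith) hh
      · show ((aOf j ℓ : ℝ) + 1 / 2) * gridH m < ((aOf j ℓ : ℝ) + 1) * gridH m
        exact mul_lt_mul_of_pos_right (by linarith) hh
    · have hsum : ∑ ℓ, (aOf j ℓ + 1) ≤ m := (Finset.mem_filter.1 (haGood j)).2
      have hsum' : ((∑ ℓ, (aOf j ℓ + 1) : ℕ) : ℝ) ≤ (m : ℝ) := by exact_mod_cast hsum
      push_cast at hsum'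
      show ∑ ℓ, ((aOf j ℓ : ℝ) + 1) * gridH m ≤ 1 / 10
      rw [← Finset.sum_mul, ← natCast_mul_gridH hm]
      exact mul_le_mul_of_nonneg_right hsum' hh.le
  -- `P` and the enumerated histogram
  have hP : ∀ t, bumpSum c' φ t = ∑ j, c (aOf j) * cellPsi k m ρ (aOf j) t := fun t => rfl
  have hSt : ∀ t, histFun k m c t =
      ∑ j, c (aOf j) * (cell k m (aOf j)).indicator (fun _ => (1 : ℝ)) t := by
    intro t
    have h1 : histFun k m c t = ∑ a ∈ A, c a * (cell k m a).indicator (fun _ => (1 : ℝ)) t := by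
      unfold histFun
      symm
      refine Finset.sum_subset (Finset.filter_subset _ _) fun a ha haA' => ?_
      have hca : c a = 0 := by
        have h0 := (hc01 a).1
        by_contra hne
        exact haA' (Finset.mem_filter.2 ⟨ha, lt_of_le_of_ne h0 (Ne.symm hne)⟩)
      rw [hca, zero_mul]
    rw [h1, ← Finset.sum_coe_sort A]
    exact (Equiv.sum_comp σ.symm (fun x : ↥A =>
      c x.1 * (cell k m x.1).indicator (fun _ => (1 : ℝ)) t)).symm
  -- `P ≤ 1`
  have hP1 : ∀ t : Fin k → ℝ, bumpSum c' φ t ≤ 1 := by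
    intro t
    rw [hP t]
    by_cases hex : ∃ j, t ∈ cell k m (aOf j)
    · obtain ⟨j₀, hj₀⟩ := hex
      rw [Finset.sum_eq_single j₀ (fun j _ hj => ?_) (fun h => (h (Finset.mem_univ _)).elim)]
      · exact mul_le_one₀ (hc01 _).2 (cellPsi_nonneg _ _ _) (cellPsi_le_one _ _ _)
      · have : t ∉ cell k m (aOf j) := fun hj' => hj (haInj (eq_of_mem_cell hm hj' hj₀))
        rw [cellPsi_eq_zero_of_not_mem hρ this, mul_zero]
    · rw [Finset.sum_eq_zero (fun j _ => by
        rw [cellPsi_eq_zero_of_not_mem hρ (fun hj => hex ⟨j, hj⟩), mul_zero])]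
      exact zero_le_one
  -- pointwise error bound `|P − S| ≤ Σ_j 1_{ramp_j}`
  set R : (Fin k → ℝ) → ℝ := fun t => ∑ j, (ramp k m ρ (aOf j)).indicator (fun _ => (1 : ℝ)) t
    with hR
  have hPS : ∀ t, |bumpSum c' φ t - histFun k m c t| ≤ R t := by
    intro t
    rw [hP t, hSt t, ← Finset.sum_sub_distrib]
    refine (Finset.abs_sum_le_sum_abs _ _).trans (Finset.sum_le_sum fun j _ => ?_)
    rw [← mul_sub, abs_mul, abs_of_pos (haPos j)]
    calc c (aOf j) * |cellPsi k m ρ (aOf j) t - (cell k m (aOf j)).indicator (fun _ => (1 : ℝ)) t|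
        ≤ 1 * |cellPsi k m ρ (aOf j) t - (cell k m (aOf j)).indicator (fun _ => (1 : ℝ)) t| :=
          mul_le_mul_of_nonneg_right (hc01 _).2 (abs_nonneg _)
      _ ≤ (ramp k m ρ (aOf j)).indicator (fun _ => (1 : ℝ)) t := by
          rw [one_mul]; exact abs_cellPsi_sub_indicator_le hρ _ t
  -- integrability
  have hRi : Integrable R := by
    refine integrable_finsetSum _ fun j _ => ?_
    rw [integrable_indicator_iff (measurableSet_ramp ρ _)]
    exact integrableOn_const (volume_ramp_ne_top ρ _)
  have hR0 : ∀ t, 0 ≤ R t := fun t =>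
    Finset.sum_nonneg fun j _ => Set.indicator_nonneg (fun _ _ => zero_le_one) t
  have hRint : ∫ t, R t = (J : ℝ) * (gridH m ^ k - (gridH m - 2 * ρ) ^ k) := by
    rw [hR, integral_finsetSum _ (fun j _ => ?_)]
    · simp_rw [integral_indicator_const (1 : ℝ) (measurableSet_ramp ρ _), smul_eq_mul, mul_one,
        volume_real_ramp hm hρ.le hρh, Finset.sum_const, Finset.card_univ, Fintype.card_fin,
        nsmul_eq_mul]
    · rw [integrable_indicator_iff (measurableSet_ramp ρ _)]
      exact integrableOn_const (volume_ramp_ne_top ρ _)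
  have hSGi : IntegrableOn (fun t => |histFun k m c t - G t|) orth :=
    ((integrable_histFun c).integrableOn.sub (integrableOn_scaled_orthant hFm hFs hF01)).abs
  -- the estimate
  refine ⟨J, c', w, φ, haPos, hdata, fun t _ => hP1 t, ?_⟩
  have hmono : ∫ t in orth, |bumpSum c' φ t - F ((10 : ℝ) • t)| ≤
      ∫ t in orth, (R t + |histFun k m c t - G t|) := by
    refine integral_mono_of_nonneg (Eventually.of_forall fun t => abs_nonneg _)
      (hRi.integrableOn.add hSGi) (Eventually.of_forall fun t => ?_)
    calc |bumpSum c' φ t - F ((10 : ℝ) • t)|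
        ≤ |bumpSum c' φ t - histFun k m c t| + |histFun k m c t - G t| := abs_sub_le _ _ _
      _ ≤ R t + |histFun k m c t - G t| := by linarith [hPS t]
  calc ∫ t in orth, |bumpSum c' φ t - F ((10 : ℝ) • t)|
      ≤ ∫ t in orth, (R t + |histFun k m c t - G t|) := hmono
    _ = (∫ t in orth, R t) + ∫ t in orth, |histFun k m c t - G t| :=
        integral_add hRi.integrableOn hSGi
    _ ≤ (∫ t, R t) + δ / 2 :=
        add_le_add (setIntegral_le_integral hRi (Eventually.of_forall hR0)) hS
    _ ≤ δ / 2 + δ / 2 := by rw [hRint]; linarith [hρJ]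
    _ = δ := by ring

/-- `L1DensityBdd` from histogram density. [cite: Maynard2016LargeGaps, Lemma 8 (proof)] -/
theorem l1DensityBdd_of_histDensity (hH : HistDensity) : L1DensityBdd :=
  l1DensityBdd_of_orth (l1DensityOrth_of_histDensity hH)

/-- `Lemma8` from histogram density. [cite: Maynard2016LargeGaps, Lemma 8] -/
theorem lemma8_of_histDensity (hH : HistDensity) : Lemma8 :=
  lemma8_of_l1DensityOrth (l1DensityOrth_of_histDensity hH)

/-- **Maynard's Theorem 1 from `Lemma7` and `HistDensity`.** [cite: Maynard2016LargeGaps, Theorem 1] -/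
theorem theorem1_of_lemma7_histDensity (h7 : Lemma7) (hH : HistDensity) :
    Literature.NumberTheory.Sieve.Maynard2016_theorem1 :=
  theorem1_of_lemma7_l1DensityOrth h7 (l1DensityOrth_of_histDensity hH)

/-- **`∀ c, RankinConstant c` from `Lemma7` and `HistDensity`.** [cite: Maynard2016LargeGaps, Theorem 1] -/
theorem forall_rankinConstant_of_lemma7_histDensity (h7 : Lemma7) (hH : HistDensity) (c : ℝ) :
    Literature.NumberTheory.Sieve.RankinConstant c :=
  forall_rankinConstant_of_lemma7_l1DensityOrth h7 (l1DensityOrth_of_histDensity hH) c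

end Maynard2016

end Literature.NumberTheory.Sieve
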